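import Literature.Topology.FourManifolds.FourTorusSignature
import Literature.Topology.FourManifolds.SimplyConnectedEulerCharacteristic
import Literature.Topology.FourManifolds.ConnectedSumProofs
import Literature.Topology.FourManifolds.SphereProductMiddleHomology
import Literature.AlgebraicTopology.SingularHomology.EulerCharacteristicTriple
import Literature.AlgebraicTopology.SingularHomology.PairTimesCircle
import Literature.AlgebraicTopology.SingularHomology.HomologySpheresProofs
import Literature.AlgebraicTopology.SingularHomology.ExcisionTheorem
import Literature.AlgebraicTopology.SingularHomology.LocalHomologyIso
import Literature.AlgebraicTopology.SingularHomology.LocalHomologyVanishing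
import Mathlib.Analysis.SpecialFunctions.Complex.Circle
import HarnessLib

/-!
# The Euler characteristic of a connected sum of closed 4-manifolds: `e(M # N) = e(M) + e(N) - 2`

Topic `Literature/Topology/FourManifolds`.  R. Gompf, A. Stipsicz, *4-Manifolds and Kirby
Calculus* (1999), §1.2 / R. Kirby, *The topology of 4-manifolds* (1989), Ch. II §1 (homology of
connected sums); A. Hatcher, *Algebraic Topology* (2002), §2.2 p. 146 and Thm. 2.44 (the Euler
characteristic `χ = Σ (-1)^k rank H_k` is additive along exact sequences), §2.1 p. 118 (exact
sequence of a triple), Thm. 2.20 (excision), §3.3 p. 231 (local homology of a manifold).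
A. Akhmedov, B. D. Park, Invent. Math. 181 (2010), §4 and §9 (proof of Lemma 8):
"`e(Z') = e(Z''(1/q, m/r)) = 1`", i.e. `e(T⁴ # ℂℙ²bar) = e(T⁴) + e(ℂℙ²) - 2 = 0 + 3 - 2`.

The sibling Barriers file `SmallExoticaFrontierReductionLemma8Proofs.lean` (§6–§8) proves the
count `e(A # B) = e(A) + e(B) - 2` in COVER form (for a space presented by two compact pieces
meeting in `S³`, through Čech cohomology and the ENR theorem), leaving it to "the construction"
to present an actual connected sum that way.  This file proves the count for the tree's actual
connected sums `IsConnectedSum (𝓡 4) (𝓡 4) (𝓡 4) M N P` (`ConnectedSum.lean`), by the OPEN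
cover of `P` by the punctured summands and plain singular homology — no orientability, no
smoothness of `P` and no Čech theory are needed.  Everything is PROVED (no definition, no named
fact); the Euler characteristic is the tree's `relEuler ℤ ℤ X ∅` with the finiteness predicate
`FinRelHomology` (`EulerCharacteristicTriple.lean`):

* `finRelHomology_and_relEuler_of_isOpen_cover` — **`χ(U ∪ V) = χ(U) + χ(V) - χ(U ∩ V)` for an
  open cover with pieces of finite homological type** (Hatcher Thm. 2.44 via the triples
  `∅ ⊆ U ⊆ P`, `∅ ⊆ U ∩ V ⊆ V` and excision `H_•(V, U ∩ V) ≅ H_•(P, U)`; the tree's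
  `FinRelHomology.triple_mid/right`, `isIso_map_of_interior_union_interior_holds`).
* `finRelHomology_and_relEuler_compl_singleton_four` — **`χ(M ∖ pt) = χ(M) - 1`** for a closed
  topological `4`-manifold (triple `∅ ⊆ M ∖ pt ⊆ M`; `H_•(M | pt) = ℤ` in degree `4`, else `0`).
* `finRelHomology_and_relEuler_sphere_three`, `finRelHomology_and_relEuler_puncturedBall_four` —
  `χ(S³) = 0` and `χ = 0` for the punctured open `4`-ball, which deformation retracts onto a round
  `S³` (`nonempty_homotopyEquiv_sphere_puncturedBall`).
* `IsConnectedSum.exists_isOpen_cover` — the open cover of a connected sum by its punctured summands, the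
  overlap being the punctured unit ball (data extraction from `IsConnectedSum`, any dimension).
* `IsConnectedSum.finRelHomology_and_relEuler_eq` — **`e(M # N) = e(M) + e(N) - 2`** with
  finiteness, for Hausdorff topological `4`-manifolds `M`, `N` which are compact, and any `P` with
  `IsConnectedSum (𝓡 4) (𝓡 4) (𝓡 4) M N P`: `P = U ∪ V`, `U ≅ M ∖ pt`, `V ≅ N ∖ pt`,
  `U ∩ V ≅` punctured ball, so `χ(P) = (χ(M) - 1) + (χ(N) - 1) - 0`.
* `IsConnectedSum.nonempty_singularHomology_succ_iso_biprod_four` — **`H_k(M # N) ≅ H_k(M) ⊕ H_k(N)`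
  for `k = 1, 2`** (so `b₁`, `b₂` are additive; Mayer–Vietoris, no orientability; Kosinski VI.2).
* `relEuler_complexProjectivePlane` (`e(ℂℙ²) = 3`),
  `finRelHomology_and_relEuler_of_homeomorph_fourTorus` (`e(T⁴) = 0`), and `exists_oriented_isConnectedSum_fourTorus_complexProjectivePlane_relEuler` —
  **Akhmedov–Park's `(e, σ)(T⁴ # ℂℙ²bar) = (1, -1)` on one model**: the oriented `4`-torus `X`
  (`σ(X, μ) = 0`, `e(X) = 0`) and a connected sum `P` of `X` with `ℂℙ²` carrying an orientation
  of signature `-1`, with `b₂(P) = b₂(X) + 1` AND `e(P) = 1`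
  (`FourTorusSignature.exists_oriented_isConnectedSum_fourTorus_complexProjectivePlane` combined
  with the present count).  The torus-surgery invariance of `e`, `σ` (passage to `Z'`, `Z''`) is
  NOT formalised here.

## References

* R. E. Gompf, A. I. Stipsicz, *4-Manifolds and Kirby Calculus*, GSM 20, AMS 1999, §1.2. [GompfStipsicz1999]
* R. C. Kirby, *The Topology of 4-Manifolds*, LNM 1374, Springer 1989, Ch. II §1. [Kirby1989]
* A. Kosinski, *Differential Manifolds*, Academic Press 1993, Ch. VI §1–§2. [Kosinski1993]
* A. Hatcher, *Algebraic Topology*, CUP 2002, §2.1 p. 118, Thm. 2.20, §2.2 p. 146, Thm. 2.44,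
  Cor. 2.11, Cor. 2.14, §3.3 p. 231. [HatcherAT2002]
* A. Akhmedov, B. D. Park, Invent. Math. 181 (2010) 577–603, §4 and §9. [AkhmedovPark2010]
-/

noncomputable section

open Set Function CategoryTheory CategoryTheory.Limits Module
open scoped Manifold ContDiff Topology
open Literature.AlgebraicTopology.SingularHomology

namespace Literature.Topology.FourManifolds

/-! ### The Euler characteristic of an open cover with two pieces -/

section OpenCover

variable {P : Type} [TopologicalSpace P]

/-- **`χ(U ∪ V) = χ(U) + χ(V) - χ(U ∩ V)` with finiteness, for an open cover `P = U ∪ V`**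
(Hatcher 2002, §2.2 Thm. 2.44, proof: the Euler characteristic is additive along exact sequences
of finitely generated groups).  If the integral homology of `U`, `V` and `U ∩ V` is finitely
generated and vanishes from degree `N` on, then the homology of `P` is finitely generated,
vanishes from degree `N + 1` on, and the Euler characteristics satisfy inclusion–exclusion.
Proof by triples (Hatcher §2.1 p. 118): `χ(V) = χ(U ∩ V) + χ(V, U ∩ V)`
(`FinRelHomology.triple_right` in `V`), `χ(V, U ∩ V) = χ(P, U)` by excision (Thm. 2.20, the
tree's `isIso_map_of_interior_union_interior_holds`), and `χ(P) = χ(U) + χ(P, U)`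
(`FinRelHomology.triple_mid`). [cite: HatcherAT2002, §2.2 Thm. 2.44 (proof), §2.1 p. 118, Thm. 2.20] -/
theorem finRelHomology_and_relEuler_of_isOpen_cover {U V : Set P} (hU : IsOpen U) (hV : IsOpen V)
    (hUV : U ∪ V = univ) {N : ℕ} (hFU : FinRelHomology ℤ ℤ ↥U ∅ N)
    (hFV : FinRelHomology ℤ ℤ ↥V ∅ N) (hFUV : FinRelHomology ℤ ℤ ↥(U ∩ V) ∅ N) :
    FinRelHomology ℤ ℤ P ∅ (N + 1) ∧
      relEuler ℤ ℤ P ∅ = relEuler ℤ ℤ ↥U ∅ + relEuler ℤ ℤ ↥V ∅ - relEuler ℤ ℤ ↥(U ∩ V) ∅ := by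
  have hint : interior U ∪ interior V = univ := by rw [hU.interior_eq, hV.interior_eq, hUV]
  -- the trace `W = V ↓∩ U` of `U` on `V` is a copy of `U ∩ V`
  let e : ↥(U ∩ V) ≃ₜ ↥(Subtype.val ⁻¹' U : Set ↥V) :=
    (Homeomorph.setCongr (inter_comm U V)).trans (preimageValHomeomorph V U).symm
  have hW : FinRelHomology ℤ ℤ ↥(Subtype.val ⁻¹' U : Set ↥V) (Subtype.val ⁻¹' ∅) N :=
    (hFUV.of_homeomorph e (mapsTo_empty _ _) (mapsTo_empty _ _)).congr_set (preimage_empty).symm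
  have hWe : relEuler ℤ ℤ ↥(Subtype.val ⁻¹' U : Set ↥V) (Subtype.val ⁻¹' ∅) =
      relEuler ℤ ℤ ↥(U ∩ V) ∅ := by
    rw [relEuler_congr_set (R := ℤ) (M := ℤ) (X := ↥(Subtype.val ⁻¹' U : Set ↥V))
      (preimage_empty (f := (Subtype.val : ↥(Subtype.val ⁻¹' U : Set ↥V) → ↥V)))]
    exact (relEuler_eq_of_homeomorph (R := ℤ) (M := ℤ) (A := (∅ : Set ↥(U ∩ V))) e
      (mapsTo_empty _ _) (mapsTo_empty _ _)).symm
  -- (1) the triple `∅ ⊆ W ⊆ V` in `V`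
  obtain ⟨hVW, hVWe⟩ := FinRelHomology.triple_right (R := ℤ) (M := ℤ)
    (empty_subset (Subtype.val ⁻¹' U : Set ↥V)) hW hFV
  -- (2) excision `H_•(V, W) ≅ H_•(P, U)`
  have hexc := relativeSingularHomology.isIso_map_of_interior_union_interior_holds ℤ ℤ P U V hint
  let ex : ∀ k, relativeSingularHomology ℤ ℤ ↥V (Subtype.val ⁻¹' U) k ≅
      relativeSingularHomology ℤ ℤ P U k := fun k =>
    @asIso _ _ _ _ (relativeSingularHomology.map ℤ ℤ (X := ↥V) (subsetIncl V)
      (mapsTo_preimage Subtype.val U : MapsTo _ (Subtype.val ⁻¹' U) U) k) (hexc k)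
  have hPU : FinRelHomology ℤ ℤ P U (N + 1) := hVW.of_iso ex
  have hPUe : relEuler ℤ ℤ ↥V (Subtype.val ⁻¹' U) = relEuler ℤ ℤ P U := relEuler_eq_of_iso ex
  -- (3) the triple `∅ ⊆ U ⊆ P` in `P`
  have hU' : FinRelHomology ℤ ℤ ↥U (Subtype.val ⁻¹' ∅) (N + 1) :=
    (hFU.mono (Nat.le_succ N)).congr_set (preimage_empty).symm
  obtain ⟨hPfin, hPe⟩ := FinRelHomology.triple_mid (R := ℤ) (M := ℤ) (empty_subset U) hU' hPU
  refine ⟨hPfin, ?_⟩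
  rw [hPe, relEuler_congr_set (R := ℤ) (M := ℤ) (X := ↥U)
    (preimage_empty (f := (Subtype.val : ↥U → P))), ← hPUe]
  rw [hWe] at hVWe
  linarith

end OpenCover

/-! ### Puncturing a closed 4-manifold costs one -/

section Puncture

variable {M : Type} [TopologicalSpace M] [T2Space M] [CompactSpace M]
  [ChartedSpace (EuclideanSpace ℝ (Fin 4)) M]

omit [CompactSpace M] in
/-- **The local homology of a `4`-manifold at a point has finite type and `χ(M | x) = 1`**:
`H_k(M | x; ℤ)` is `ℤ` for `k = 4` and `0` otherwise (Hatcher 2002, §3.3 p. 231; the tree's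
`nonempty_localHomology_iso_holds`, `isZero_localHomology_holds`). [cite: HatcherAT2002, §3.3 p. 231] -/
theorem finRelHomology_and_relEuler_localHomology_four (x : M) :
    FinRelHomology ℤ ℤ M ({x}ᶜ : Set M) 5 ∧ relEuler ℤ ℤ M ({x}ᶜ : Set M) = 1 := by
  obtain ⟨e4⟩ := nonempty_localHomology_iso_holds ℤ M (n := 4) x
  have hZ : ∀ k, k ≠ 4 → IsZero (relativeSingularHomology ℤ ℤ M ({x}ᶜ : Set M) k) :=
    fun k hk => isZero_localHomology_holds ℤ ℤ M (n := 4) x hk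
  have hfin : ∀ k, Module.Finite ℤ (relativeSingularHomology ℤ ℤ M ({x}ᶜ : Set M) k) := by
    intro k
    by_cases hk : k = 4
    · subst hk
      exact Module.Finite.equiv e4.toLinearEquiv.symm
    · exact finite_of_isZero (hZ k hk)
  have h : FinRelHomology ℤ ℤ M ({x}ᶜ : Set M) 5 := ⟨hfin, fun k hk => hZ k (by omega)⟩
  refine ⟨h, ?_⟩
  rw [h.relEuler_eq_sum]
  simp only [Finset.sum_range_succ, Finset.sum_range_zero]
  rw [e4.toLinearEquiv.finrank_eq, finrank_ulift_int,
    finrank_eq_zero_of_isZero (hZ 0 (by norm_num)), finrank_eq_zero_of_isZero (hZ 1 (by norm_num)),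
    finrank_eq_zero_of_isZero (hZ 2 (by norm_num)), finrank_eq_zero_of_isZero (hZ 3 (by norm_num))]
  norm_num

/-- **Puncturing costs one: `χ(M ∖ {x}) = χ(M) - 1`** for a closed (compact, Hausdorff)
topological `4`-manifold, with finiteness of the homology of `M ∖ {x}` (finitely generated, zero
from degree `5` on).  Triple `∅ ⊆ M ∖ {x} ⊆ M` (Hatcher 2002, §2.1 p. 118 and Thm. 2.44): the
homology of `M` is of finite type (App. A Cor. A.8–A.9, the tree's PROVED
`finite_singularHomology_of_compactSpace_holds`, `isZero_singularHomology_of_lt_holds`, packaged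
as `finRelHomology_of_compactSpace_four`) and `χ(M | x) = 1`.
[cite: HatcherAT2002, §2.2 Thm. 2.44 and §3.3 p. 231] -/
theorem finRelHomology_and_relEuler_compl_singleton_four (x : M) :
    FinRelHomology ℤ ℤ ↥({x}ᶜ : Set M) ∅ 5 ∧
      relEuler ℤ ℤ ↥({x}ᶜ : Set M) ∅ = relEuler ℤ ℤ M ∅ - 1 := by
  obtain ⟨hXA, hXAe⟩ := finRelHomology_and_relEuler_localHomology_four x
  obtain ⟨hA, hAe⟩ := FinRelHomology.triple_left (R := ℤ) (M := ℤ) (empty_subset ({x}ᶜ : Set M))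
    (finRelHomology_of_compactSpace_four M) hXA
  refine ⟨hA.congr_set preimage_empty, ?_⟩
  rw [relEuler_congr_set (R := ℤ) (M := ℤ) (X := ↥({x}ᶜ : Set M))
    (preimage_empty (f := (Subtype.val : ↥({x}ᶜ : Set M) → M)))] at hAe
  linarith

end Puncture

/-! ### The punctured ball deformation retracts onto a sphere -/

section PuncturedBall

/-- **The punctured open unit ball `{v | 0 < ‖v‖ < 1}` of `ℝᵐ⁺¹ is homotopy equivalent to the
round sphere `Sᵐ`**: the inclusion `y ↦ y/2` of the unit sphere and the radial retraction
`v ↦ v/‖v‖` are mutually inverse up to the straight-line homotopy `((1 - t)/(2‖v‖) + t) v`,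
which stays in the punctured ball (Hatcher 2002, proof of Thm. 2.26: "`ℝⁿ - {0}` deformation
retracts onto `Sⁿ⁻¹`"). [cite: HatcherAT2002, Thm. 2.26 (proof)] -/
theorem nonempty_homotopyEquiv_sphere_puncturedBall (m : ℕ) :
    Nonempty (ContinuousMap.HomotopyEquiv ↥(Metric.sphere (0 : EuclideanSpace ℝ (Fin (m + 1))) 1)
      ↥({v : EuclideanSpace ℝ (Fin (m + 1)) | 0 < ‖v‖ ∧ ‖v‖ < 1})) := by
  set D : Set (EuclideanSpace ℝ (Fin (m + 1))) := {v | 0 < ‖v‖ ∧ ‖v‖ < 1} with hD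
  have hS : ∀ y : ↥(Metric.sphere (0 : EuclideanSpace ℝ (Fin (m + 1))) 1),
      ‖(y : EuclideanSpace ℝ (Fin (m + 1)))‖ = 1 := fun y => by
    have := y.2
    rwa [mem_sphere_zero_iff_norm] at this
  -- the inclusion of the sphere of radius `1/2`
  let f : C(↥(Metric.sphere (0 : EuclideanSpace ℝ (Fin (m + 1))) 1), ↥D) :=
    ⟨fun y => ⟨(1 / 2 : ℝ) • (y : EuclideanSpace ℝ (Fin (m + 1))), by
        simp only [hD, mem_setOf_eq, norm_smul, hS y]
        norm_num⟩, by fun_prop⟩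
  -- the radial retraction
  have hgc : Continuous fun v : ↥D =>
      ‖(v : EuclideanSpace ℝ (Fin (m + 1)))‖⁻¹ • (v : EuclideanSpace ℝ (Fin (m + 1))) :=
    ((continuous_subtype_val.norm).inv₀ fun v : ↥D => v.2.1.ne').smul continuous_subtype_val
  have hgm : ∀ v : ↥D, ‖(v : EuclideanSpace ℝ (Fin (m + 1)))‖⁻¹ •
      (v : EuclideanSpace ℝ (Fin (m + 1))) ∈ Metric.sphere (0 : EuclideanSpace ℝ (Fin (m + 1))) 1 :=
    fun v => by
      rw [mem_sphere_zero_iff_norm, norm_smul, norm_inv, norm_norm, inv_mul_cancel₀ v.2.1.ne']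
  let g : C(↥D, ↥(Metric.sphere (0 : EuclideanSpace ℝ (Fin (m + 1))) 1)) :=
    ⟨fun v => ⟨‖(v : EuclideanSpace ℝ (Fin (m + 1)))‖⁻¹ • (v : EuclideanSpace ℝ (Fin (m + 1))), hgm v⟩,
      hgc.subtype_mk hgm⟩
  have hgf : g.comp f = ContinuousMap.id _ := by
    ext y : 1
    apply Subtype.ext
    simp only [ContinuousMap.comp_apply, ContinuousMap.coe_mk, ContinuousMap.id_apply, f, g]
    rw [norm_smul, hS y, smul_smul]
    norm_num
  -- straight-line homotopy from `f ∘ g` to the identity, inside `D`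
  have hmem : ∀ (t : unitInterval) (v : ↥D),
      ((1 - (t : ℝ)) * (2 * ‖(v : EuclideanSpace ℝ (Fin (m + 1)))‖)⁻¹ + (t : ℝ)) •
        (v : EuclideanSpace ℝ (Fin (m + 1))) ∈ D := by
    intro t v
    have hv0 := v.2.1
    have hv1 := v.2.2
    have ht0 : 0 ≤ (t : ℝ) := t.2.1
    have ht1 : (t : ℝ) ≤ 1 := t.2.2
    have hcoef : 0 ≤ (1 - (t : ℝ)) * (2 * ‖(v : EuclideanSpace ℝ (Fin (m + 1)))‖)⁻¹ + (t : ℝ) := by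
      have : 0 ≤ (2 * ‖(v : EuclideanSpace ℝ (Fin (m + 1)))‖)⁻¹ := by positivity
      nlinarith
    simp only [hD, mem_setOf_eq, norm_smul, Real.norm_eq_abs, abs_of_nonneg hcoef]
    have hkey : ((1 - (t : ℝ)) * (2 * ‖(v : EuclideanSpace ℝ (Fin (m + 1)))‖)⁻¹ + (t : ℝ)) *
        ‖(v : EuclideanSpace ℝ (Fin (m + 1)))‖ =
          (1 - (t : ℝ)) * (1 / 2) + (t : ℝ) * ‖(v : EuclideanSpace ℝ (Fin (m + 1)))‖ := by
      field_simp
    rw [hkey]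
    constructor <;> nlinarith
  have hHc : Continuous fun p : unitInterval × ↥D =>
      ((1 - (p.1 : ℝ)) * (2 * ‖(p.2 : EuclideanSpace ℝ (Fin (m + 1)))‖)⁻¹ + (p.1 : ℝ)) •
        (p.2 : EuclideanSpace ℝ (Fin (m + 1))) := by
    have h2 : Continuous fun p : unitInterval × ↥D => (p.2 : EuclideanSpace ℝ (Fin (m + 1))) :=
      continuous_subtype_val.comp continuous_snd
    have h1 : Continuous fun p : unitInterval × ↥D => (p.1 : ℝ) :=
      continuous_subtype_val.comp continuous_fst
    have h3 : Continuous fun p : unitInterval × ↥D =>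
        (1 - (p.1 : ℝ)) * (2 * ‖(p.2 : EuclideanSpace ℝ (Fin (m + 1)))‖)⁻¹ + (p.1 : ℝ) :=
      ((continuous_const.sub h1).mul
        ((continuous_const.mul h2.norm).inv₀ fun p => mul_ne_zero two_ne_zero p.2.2.1.ne')).add h1
    exact h3.smul h2
  let H : (f.comp g).Homotopy (ContinuousMap.id ↥D) :=
    { toFun := fun p => ⟨((1 - (p.1 : ℝ)) * (2 * ‖(p.2 : EuclideanSpace ℝ (Fin (m + 1)))‖)⁻¹ +
          (p.1 : ℝ)) • (p.2 : EuclideanSpace ℝ (Fin (m + 1))), hmem p.1 p.2⟩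
      continuous_toFun := hHc.subtype_mk fun p => hmem p.1 p.2
      map_zero_left := fun v => by
        apply Subtype.ext
        simp only [ContinuousMap.comp_apply, ContinuousMap.coe_mk, f, g]
        rw [smul_smul]
        congr 1
        simp [mul_comm]
      map_one_left := fun v => by
        apply Subtype.ext
        simp }
  exact ⟨{ toFun := f
           invFun := g
           left_inv := by rw [hgf]
           right_inv := ⟨H⟩ }⟩

/-- **`χ(S³) = 0`, with finiteness** (`S³ ⊆ ℝ⁴` round): the integral homology of `S³` is
`ℤ, 0, 0, ℤ, 0, …` (Hatcher 2002, Cor. 2.14 and Prop. 2.7; the tree's PROVED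
`isHomologySphere_sphere`), so it is finitely generated, vanishes from degree `4` on, and
`χ(S³) = 1 - 1 = 0` (same computation as the sibling Barriers file's `finRelHomology_sphere_three`,
which is not importable here). [cite: HatcherAT2002, Cor. 2.14] -/
theorem finRelHomology_and_relEuler_sphere_three :
    FinRelHomology ℤ ℤ ↥(Metric.sphere (0 : EuclideanSpace ℝ (Fin 4)) 1) ∅ 4 ∧
      relEuler ℤ ℤ ↥(Metric.sphere (0 : EuclideanSpace ℝ (Fin 4)) 1) ∅ = 0 := by
  have hS : IsHomologySphere (Metric.sphere (0 : EuclideanSpace ℝ (Fin 4)) 1) 3 :=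
    isHomologySphere_sphere (n := 3) (by norm_num)
  haveI : PathConnectedSpace (Metric.sphere (0 : EuclideanSpace ℝ (Fin 4)) 1) := by
    refine isPathConnected_iff_pathConnectedSpace.mp (isPathConnected_sphere ?_ 0 zero_le_one)
    rw [← Module.finrank_eq_rank, finrank_euclideanSpace_fin]
    exact Nat.one_lt_cast.mpr (by norm_num)
  haveI := singularHomology.isIso_ε_of_pathConnectedSpace ℤ ℤ
    (X := Metric.sphere (0 : EuclideanSpace ℝ (Fin 4)) 1)
  let e0 : singularHomology ℤ ℤ (Metric.sphere (0 : EuclideanSpace ℝ (Fin 4)) 1) 0 ≅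
      ModuleCat.of ℤ (ULift.{0} ℤ) :=
    asIso (singularHomology.ε ℤ ℤ (Metric.sphere (0 : EuclideanSpace ℝ (Fin 4)) 1))
  let e3 : singularHomology ℤ ℤ (Metric.sphere (0 : EuclideanSpace ℝ (Fin 4)) 1) 3 ≅
      ModuleCat.of ℤ (ULift.{0} ℤ) :=
    hS.nonempty_iso.some
  have hZ : ∀ k, k ≠ 0 → k ≠ 3 →
      IsZero (singularHomology ℤ ℤ (Metric.sphere (0 : EuclideanSpace ℝ (Fin 4)) 1) k) :=
    fun k hk0 hk3 => hS.1 k (Nat.pos_of_ne_zero hk0) hk3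
  have hfin : ∀ k,
      Module.Finite ℤ (singularHomology ℤ ℤ (Metric.sphere (0 : EuclideanSpace ℝ (Fin 4)) 1) k) := by
    intro k
    by_cases hk0 : k = 0
    · subst hk0; exact Module.Finite.equiv e0.toLinearEquiv.symm
    by_cases hk3 : k = 3
    · subst hk3; exact Module.Finite.equiv e3.toLinearEquiv.symm
    exact finite_of_isZero (hZ k hk0 hk3)
  have h : FinRelHomology ℤ ℤ (Metric.sphere (0 : EuclideanSpace ℝ (Fin 4)) 1) ∅ 4 :=
    FinRelHomology.empty_of_absolute hfin fun k hk => hZ k (by omega) (by omega)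
  refine ⟨h, ?_⟩
  rw [h.relEuler_empty_eq_sum]
  simp only [Finset.sum_range_succ, Finset.sum_range_zero]
  rw [e0.toLinearEquiv.finrank_eq, e3.toLinearEquiv.finrank_eq, finrank_ulift_int,
    finrank_eq_zero_of_isZero (hZ 1 (by norm_num) (by norm_num)),
    finrank_eq_zero_of_isZero (hZ 2 (by norm_num) (by norm_num))]
  norm_num

/-- **The punctured open `4`-ball has `χ = 0`, with finiteness**: it is homotopy equivalent to
`S³` (`nonempty_homotopyEquiv_sphere_puncturedBall`; Hatcher 2002, Cor. 2.11, homotopy invariance,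
the tree's `singularHomology.isoOfHomotopyEquiv`), and `χ(S³) = 0`.
[cite: HatcherAT2002, Cor. 2.11 and Cor. 2.14] -/
theorem finRelHomology_and_relEuler_puncturedBall_four :
    FinRelHomology ℤ ℤ ↥({v : EuclideanSpace ℝ (Fin 4) | 0 < ‖v‖ ∧ ‖v‖ < 1}) ∅ 4 ∧
      relEuler ℤ ℤ ↥({v : EuclideanSpace ℝ (Fin 4) | 0 < ‖v‖ ∧ ‖v‖ < 1}) ∅ = 0 := by
  obtain ⟨hS, hSe⟩ := finRelHomology_and_relEuler_sphere_three
  obtain ⟨e⟩ := nonempty_homotopyEquiv_sphere_puncturedBall 3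
  let ek : ∀ k,
      relativeSingularHomology ℤ ℤ ↥(Metric.sphere (0 : EuclideanSpace ℝ (Fin 4)) 1) ∅ k ≅
        relativeSingularHomology ℤ ℤ ↥({v : EuclideanSpace ℝ (Fin 4) | 0 < ‖v‖ ∧ ‖v‖ < 1}) ∅ k :=
    fun k => (relativeSingularHomology.emptyIso ℤ ℤ _ k).symm ≪≫
      singularHomology.isoOfHomotopyEquiv ℤ ℤ e k ≪≫ relativeSingularHomology.emptyIso ℤ ℤ _ k
  exact ⟨hS.of_iso ek, (relEuler_eq_of_iso ek).symm.trans hSe⟩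

end PuncturedBall

/-! ### `e(M # N) = e(M) + e(N) - 2` -/

section ConnectedSum

/-- **The open cover of a connected sum by its punctured summands** (data extraction from the
tree's `IsConnectedSum (𝓡 n) (𝓡 n) (𝓡 n) M N P`, Kervaire–Milnor 1963 §2 / Kosinski VI.1): there
are open sets `U`, `V` covering `P` with `U ≅ M ∖ {x}`, `V ≅ N ∖ {y}` (the images of the gluing
embeddings of the punctured summands) and `U ∩ V` homeomorphic to the punctured open unit ball
`{v | 0 < ‖v‖ < 1}` of `ℝⁿ` (the image of the punctured disc, identified through Kervaire–Milnor's
relation `i₁(t u) ∼ i₂((1 - t) u)`). [cite: Kosinski1993, Ch. VI §1–§2 (proof of Prop. 2.1)] -/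
theorem IsConnectedSum.exists_isOpen_cover {n : ℕ} {M N P : Type}
    [TopologicalSpace M] [T2Space M] [ChartedSpace (EuclideanSpace ℝ (Fin n)) M]
    [TopologicalSpace N] [T2Space N] [ChartedSpace (EuclideanSpace ℝ (Fin n)) N]
    [TopologicalSpace P] [ChartedSpace (EuclideanSpace ℝ (Fin n)) P]
    (h : IsConnectedSum (𝓡 n) (𝓡 n) (𝓡 n) M N P) :
    ∃ (U V : Set P) (x : M) (y : N), IsOpen U ∧ IsOpen V ∧ U ∪ V = univ ∧
      Nonempty (↥({v : EuclideanSpace ℝ (Fin n) | 0 < ‖v‖ ∧ ‖v‖ < 1}) ≃ₜ ↥(U ∩ V)) ∧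
        Nonempty (↥({x}ᶜ : Set M) ≃ₜ ↥U) ∧ Nonempty (↥({y}ᶜ : Set N) ≃ₜ ↥V) := by
  obtain ⟨i₁, i₂, h₁, h₂, jA, jB, hjA, hjAo, hjB, hjBo, hcov, hR⟩ := h
  set D : Set (EuclideanSpace ℝ (Fin n)) := {v | 0 < ‖v‖ ∧ ‖v‖ < 1} with hD
  have hDne : ∀ v ∈ D, v ≠ 0 := fun v hv h0 => by
    rw [h0, hD, mem_setOf_eq, norm_zero] at hv
    exact lt_irrefl _ hv.1
  have hD0 : ∀ v ∈ D, i₁ v ∈ puncture i₁ := fun v hv h0 =>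
    hDne v hv (h₁.isEmbedding.injective h0)
  let g : ↥D → ↥(puncture i₁) := fun v => ⟨i₁ v, hD0 v v.2⟩
  have hg : Topology.IsEmbedding g := by
    rw [← Topology.IsEmbedding.subtypeVal.of_comp_iff]
    exact h₁.isEmbedding.comp Topology.IsEmbedding.subtypeVal
  have heD : Topology.IsEmbedding (jA ∘ g) := hjA.isEmbedding.comp hg
  have hRD : ∀ a : puncture i₁, (∃ b, connectedSumRel i₁ i₂ a b) ↔ (a : M) ∈ i₁ '' D := by
    intro a
    constructor
    · rintro ⟨b, u, t, hu, ht, ha, -⟩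
      refine ⟨t • u, ?_, ha.symm⟩
      rw [hD, mem_setOf_eq, norm_smul, hu, mul_one, Real.norm_eq_abs, abs_of_pos ht.1]
      exact ht
    · rintro ⟨v, hv, hva⟩
      have hv0 : v ≠ 0 := hDne v hv
      have hn0 : ‖v‖ ≠ 0 := norm_ne_zero_iff.2 hv0
      have hu : ‖‖v‖⁻¹ • v‖ = 1 := by
        rw [norm_smul, norm_inv, norm_norm, inv_mul_cancel₀ hn0]
      have hne : (1 - ‖v‖) • ‖v‖⁻¹ • v ≠ 0 := by
        refine smul_ne_zero (sub_ne_zero.2 hv.2.ne') (smul_ne_zero (inv_ne_zero hn0) hv0)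
      refine ⟨⟨i₂ ((1 - ‖v‖) • ‖v‖⁻¹ • v), fun h => hne (h₂.isEmbedding.injective h)⟩,
        ‖v‖⁻¹ • v, ‖v‖, hu, ⟨hv.1, hv.2⟩, ?_, rfl⟩
      rw [← hva, smul_smul, mul_inv_cancel₀ hn0, one_smul]
  have hW : range (jA ∘ g) = range jA ∩ range jB := by
    ext z
    constructor
    · rintro ⟨v, rfl⟩
      refine ⟨⟨g v, rfl⟩, ?_⟩
      obtain ⟨b, hb⟩ := (hRD (g v)).2 ⟨v, v.2, rfl⟩
      exact ⟨b, ((hR _ b).2 hb).symm⟩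
    · rintro ⟨⟨a, rfl⟩, ⟨b, hb⟩⟩
      obtain ⟨v, hv, hva⟩ := (hRD a).1 ⟨b, (hR a b).1 hb.symm⟩
      refine ⟨⟨v, hv⟩, ?_⟩
      change jA (g ⟨v, hv⟩) = jA a
      congr 1
      exact Subtype.ext hva
  exact ⟨range jA, range jB, i₁ 0, i₂ 0, hjAo, hjBo, hcov,
    ⟨heD.toHomeomorph.trans (Homeomorph.setCongr hW)⟩, ⟨hjA.isEmbedding.toHomeomorph⟩,
    ⟨hjB.isEmbedding.toHomeomorph⟩⟩

/-- **The Euler characteristic of a connected sum of closed `4`-manifolds: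
`e(M # N) = e(M) + e(N) - 2`** (Gompf–Stipsicz 1999, §1.2; Kirby 1989, Ch. II §1), with
finiteness of the homology of the sum.  For Hausdorff compact topological `4`-manifolds `M`, `N`
(charted on `ℝ⁴`) and ANY space `P` which is a connected sum of them in the sense of the tree's
`IsConnectedSum (𝓡 4) (𝓡 4) (𝓡 4) M N P` (open gluing of `M ∖ {i₁ 0}` and `N ∖ {i₂ 0}` along
Kervaire–Milnor's relation; no smoothness, orientability or compactness of `P` is used): `P` is
covered by the open pieces `U ≅ M ∖ pt`, `V ≅ N ∖ pt` meeting in the embedded punctured unit ball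
(`IsConnectedSum.exists_isOpen_cover`), so
`χ(P) = χ(M ∖ pt) + χ(N ∖ pt) - χ(S³ × (0,1)) = (χ(M) - 1) + (χ(N) - 1) - 0`
(`finRelHomology_and_relEuler_of_isOpen_cover`, `…_compl_singleton_four`, `…_puncturedBall_four`).
This is the count "`e(T⁴ # ℂℙ²bar) = 0 + 3 - 2 = 1`" of Akhmedov–Park 2010, §4/§9.
[cite: GompfStipsicz1999, §1.2] [cite: Kirby1989, Ch. II §1] [cite: AkhmedovPark2010, §9, proof of Lemma 8 ("e(Z''(1,m)) = 1")] -/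
theorem IsConnectedSum.finRelHomology_and_relEuler_eq {M N P : Type}
    [TopologicalSpace M] [T2Space M] [CompactSpace M] [ChartedSpace (EuclideanSpace ℝ (Fin 4)) M]
    [TopologicalSpace N] [T2Space N] [CompactSpace N] [ChartedSpace (EuclideanSpace ℝ (Fin 4)) N]
    [TopologicalSpace P] [ChartedSpace (EuclideanSpace ℝ (Fin 4)) P]
    (h : IsConnectedSum (𝓡 4) (𝓡 4) (𝓡 4) M N P) :
    FinRelHomology ℤ ℤ P ∅ 6 ∧ relEuler ℤ ℤ P ∅ = relEuler ℤ ℤ M ∅ + relEuler ℤ ℤ N ∅ - 2 := by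
  obtain ⟨U, V, x, y, hU, hV, hUV, ⟨eUV⟩, ⟨eU⟩, ⟨eV⟩⟩ := h.exists_isOpen_cover
  -- the Euler characteristics of the three pieces
  obtain ⟨hFD, hDe⟩ := finRelHomology_and_relEuler_puncturedBall_four
  have hFUV : FinRelHomology ℤ ℤ ↥(U ∩ V) ∅ 5 :=
    (hFD.of_homeomorph eUV (mapsTo_empty _ _) (mapsTo_empty _ _)).mono (by norm_num)
  have hUVe : relEuler ℤ ℤ ↥(U ∩ V) ∅ = 0 := by
    rw [← hDe]
    exact (relEuler_eq_of_homeomorph (R := ℤ) (M := ℤ)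
      (A := (∅ : Set ↥({v : EuclideanSpace ℝ (Fin 4) | 0 < ‖v‖ ∧ ‖v‖ < 1}))) eUV
      (mapsTo_empty _ _) (mapsTo_empty _ _)).symm
  obtain ⟨hFM, hMe⟩ := finRelHomology_and_relEuler_compl_singleton_four x
  obtain ⟨hFN, hNe⟩ := finRelHomology_and_relEuler_compl_singleton_four y
  have hFU : FinRelHomology ℤ ℤ ↥U ∅ 5 := hFM.of_homeomorph eU (mapsTo_empty _ _) (mapsTo_empty _ _)
  have hFV : FinRelHomology ℤ ℤ ↥V ∅ 5 := hFN.of_homeomorph eV (mapsTo_empty _ _) (mapsTo_empty _ _)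
  have hUe : relEuler ℤ ℤ ↥U ∅ = relEuler ℤ ℤ M ∅ - 1 := by
    rw [← hMe]
    exact (relEuler_eq_of_homeomorph (R := ℤ) (M := ℤ) (A := (∅ : Set ↥({x}ᶜ : Set M))) eU
      (mapsTo_empty _ _) (mapsTo_empty _ _)).symm
  have hVe : relEuler ℤ ℤ ↥V ∅ = relEuler ℤ ℤ N ∅ - 1 := by
    rw [← hNe]
    exact (relEuler_eq_of_homeomorph (R := ℤ) (M := ℤ) (A := (∅ : Set ↥({y}ᶜ : Set N))) eV
      (mapsTo_empty _ _) (mapsTo_empty _ _)).symm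
  -- inclusion–exclusion over the open cover
  obtain ⟨hP, hPe⟩ := finRelHomology_and_relEuler_of_isOpen_cover hU hV hUV hFU hFV hFUV
  refine ⟨hP, ?_⟩
  rw [hPe, hUe, hVe, hUVe]
  ring

/-- **`H_k(M # N; ℤ) ≅ H_k(M; ℤ) ⊕ H_k(N; ℤ)` for `k = 1, 2` and topological `4`-manifolds**
(Kosinski 1993, VI.2, proof of Prop. 2.1: "the Mayer–Vietoris sequence of the cover of `M₁ # M₂`
by the punctured summands gives `Hᵢ(M₁ # M₂) = Hᵢ(M₁) ⊕ Hᵢ(M₂)`, `0 < i < m`", here `m = 4`,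
`i ≤ 2`; Kirby 1989, Ch. II §1: `H₂(M # N) = H₂(M) ⊕ H₂(N)` — so `b₁`, `b₂` are additive, with no
orientability).  For Hausdorff `M`, `N` and any `P` with `IsConnectedSum (𝓡 4) (𝓡 4) (𝓡 4) M N P`:
in the Mayer–Vietoris sequence of the open cover of `IsConnectedSum.exists_isOpen_cover`, the
overlap is a punctured ball `≃ S³`, so `H_{j+1}(U ∩ V) = 0` for `j ≤ 1` (injectivity) and
`H₁(U ∩ V) = 0`, resp. `H₀(U ∩ V) → H₀(U)` is injective (path connected), for surjectivity;
finally `H_{j+1}(M ∖ pt) ≅ H_{j+1}(M)` since the local homology of a `4`-manifold vanishes in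
degrees `≤ 3` (Hatcher §3.3 p. 231; `isIso_map_subsetIncl_compl_singleton`).  (The sibling
Barriers file `SmallExoticaFrontierReductionStandardModelProofs.lean` has the case `k = 2` only.)
[cite: Kosinski1993, Ch. VI §2, proof of Prop. 2.1] [cite: Kirby1989, Ch. II §1, Examples] [cite: HatcherAT2002, §2.2 p. 149 and §3.3 p. 231] -/
theorem IsConnectedSum.nonempty_singularHomology_succ_iso_biprod_four {M N P : Type}
    [TopologicalSpace M] [T2Space M] [ChartedSpace (EuclideanSpace ℝ (Fin 4)) M]
    [TopologicalSpace N] [T2Space N] [ChartedSpace (EuclideanSpace ℝ (Fin 4)) N]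
    [TopologicalSpace P] [ChartedSpace (EuclideanSpace ℝ (Fin 4)) P]
    (h : IsConnectedSum (𝓡 4) (𝓡 4) (𝓡 4) M N P) {j : ℕ} (hj : j ≤ 1) :
    Nonempty (singularHomology ℤ ℤ P (j + 1) ≅
      singularHomology ℤ ℤ M (j + 1) ⊞ singularHomology ℤ ℤ N (j + 1)) := by
  obtain ⟨U, V, x, y, hU, hV, hUV, ⟨eUV⟩, ⟨eU⟩, ⟨eV⟩⟩ := h.exists_isOpen_cover
  have hint : interior U ∪ interior V = univ := by rw [hU.interior_eq, hV.interior_eq, hUV]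
  have hexc := relativeSingularHomology.isIso_map_of_interior_union_interior_holds ℤ ℤ P
  -- the overlap has the homology of `S³`
  set D : Set (EuclideanSpace ℝ (Fin 4)) := {v | 0 < ‖v‖ ∧ ‖v‖ < 1} with hD
  obtain ⟨e⟩ := nonempty_homotopyEquiv_sphere_puncturedBall 3
  have hZ : ∀ i, i ≠ 0 → i ≠ 3 → IsZero (singularHomology ℤ ℤ ↥(U ∩ V) i) := fun i hi0 hi3 =>
    (isZero_singularHomology_sphere_holds ℤ ℤ hi0 hi3).of_iso
      (singularHomology.isoOfHomotopyEquiv ℤ ℤ e i ≪≫ singularHomology.mapIso ℤ ℤ eUV i).symm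
  -- the overlap is path connected (the punctured ball is `S³ × (0,1)`)
  haveI : PathConnectedSpace ↥(U ∩ V) := by
    have hDimg : D = (fun p : EuclideanSpace ℝ (Fin 4) × ℝ => p.2 • p.1) ''
        (Metric.sphere 0 1 ×ˢ Ioo (0 : ℝ) 1) := by
      ext v
      constructor
      · intro hv
        have hv' : 0 < ‖v‖ ∧ ‖v‖ < 1 := hv
        refine ⟨(‖v‖⁻¹ • v, ‖v‖), ⟨?_, hv'⟩, ?_⟩
        · rw [mem_sphere_zero_iff_norm, norm_smul, norm_inv, norm_norm, inv_mul_cancel₀ hv'.1.ne']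
        · change ‖v‖ • ‖v‖⁻¹ • v = v
          rw [smul_smul, mul_inv_cancel₀ hv'.1.ne', one_smul]
      · rintro ⟨⟨u, t⟩, huv, rfl⟩
        obtain ⟨hu, ht⟩ : u ∈ Metric.sphere (0 : EuclideanSpace ℝ (Fin 4)) 1 ∧ t ∈ Ioo (0 : ℝ) 1 :=
          huv
        rw [mem_sphere_zero_iff_norm] at hu
        change 0 < ‖t • u‖ ∧ ‖t • u‖ < 1
        rw [norm_smul, hu, mul_one, Real.norm_eq_abs, abs_of_pos ht.1]
        exact ht
    have hDpc : IsPathConnected D := by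
      rw [hDimg]
      exact isPathConnected_puncturedDisc (by rw [finrank_euclideanSpace_fin]; norm_num)
    haveI : PathConnectedSpace ↥D := isPathConnected_iff_pathConnectedSpace.mp hDpc
    rw [pathConnectedSpace_iff_univ, ← eUV.range_coe, ← image_univ]
    exact isPathConnected_univ.image eUV.continuous
  -- `ψ_{j+1}` is injective: `φ_{j+1} = 0`
  have hφ : mayerVietoris.φ ℤ ℤ U V (j + 1) = 0 :=
    (hZ (j + 1) (Nat.succ_ne_zero j) (by omega)).eq_of_src _ _
  haveI : Mono (mayerVietoris.ψ ℤ ℤ U V (j + 1)) := (mayerVietoris.exact₁_holds ℤ ℤ U V hint (j + 1)).mono_g hφ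
  -- `ψ_{j+1}` is onto: `δ_j = 0`
  have hδ : mayerVietoris.δ ℤ ℤ U V hexc hint j = 0 := by
    rcases Nat.le_one_iff_eq_zero_or_eq_one.mp hj with rfl | rfl
    · haveI : Mono (singularHomology.map ℤ ℤ
          (subsetInclusion (inter_subset_left : U ∩ V ⊆ U)) 0) :=
        singularHomology.mono_map_zero_of_pathConnectedSpace ℤ ℤ _
      haveI : Mono (mayerVietoris.φ ℤ ℤ U V 0) := by
        unfold mayerVietoris.φ
        exact mono_of_mono_fac (biprod.lift_fst _ _)
      exact zero_of_comp_mono _ (mayerVietoris.δ_comp_φ ℤ ℤ U V hexc hint 0)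
    · exact (hZ 1 one_ne_zero (by norm_num)).eq_of_tgt _ _
  haveI : Epi (mayerVietoris.ψ ℤ ℤ U V (j + 1)) := (mayerVietoris.exact₂_holds ℤ ℤ U V hexc hint j).epi_f hδ
  haveI : IsIso (mayerVietoris.ψ ℤ ℤ U V (j + 1)) := isIso_of_mono_of_epi _
  -- the pieces: `H_{j+1}(U) ≅ H_{j+1}(M ∖ x) ≅ H_{j+1}(M)`
  have hMi : IsIso (singularHomology.map ℤ ℤ (subsetIncl ({x}ᶜ : Set M)) (j + 1)) :=
    isIso_map_subsetIncl_compl_singleton x j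
      (isZero_localHomology_holds ℤ ℤ M (n := 4) x (k := j + 1) (by omega))
      (isZero_localHomology_holds ℤ ℤ M (n := 4) x (k := j + 2) (by omega))
  have hNi : IsIso (singularHomology.map ℤ ℤ (subsetIncl ({y}ᶜ : Set N)) (j + 1)) :=
    isIso_map_subsetIncl_compl_singleton y j
      (isZero_localHomology_holds ℤ ℤ N (n := 4) y (k := j + 1) (by omega))
      (isZero_localHomology_holds ℤ ℤ N (n := 4) y (k := j + 2) (by omega))
  let iU : singularHomology ℤ ℤ ↥U (j + 1) ≅ singularHomology ℤ ℤ M (j + 1) :=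
    (singularHomology.mapIso ℤ ℤ eU (j + 1)).symm ≪≫
      @asIso _ _ _ _ (singularHomology.map ℤ ℤ (subsetIncl ({x}ᶜ : Set M)) (j + 1)) hMi
  let iV : singularHomology ℤ ℤ ↥V (j + 1) ≅ singularHomology ℤ ℤ N (j + 1) :=
    (singularHomology.mapIso ℤ ℤ eV (j + 1)).symm ≪≫
      @asIso _ _ _ _ (singularHomology.map ℤ ℤ (subsetIncl ({y}ᶜ : Set N)) (j + 1)) hNi
  exact ⟨(asIso (mayerVietoris.ψ ℤ ℤ U V (j + 1))).symm ≪≫ biprod.mapIso iU iV⟩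

end ConnectedSum

/-! ### Akhmedov–Park's `(e, σ)(T⁴ # ℂℙ²bar) = (1, -1)` on one model -/

section FourTorus

/-- **`e(ℂℙ²) = 3`** for the tree's complex projective plane (closed, simply connected, with
`H₂(ℂℙ²; ℤ) ≅ ℤ`, `ComplexProjectivePlane.singularHomologyTwoIso`): `χ = 2 + rank H₂ = 3`
(`relEuler_eq_two_add_finrank_singularHomology_two_of_simplyConnectedSpace`; Gompf–Stipsicz 1999,
§1.2). With the orientation reversed, `e(ℂℙ²bar) = 3` is the same number (same space).
[cite: GompfStipsicz1999, §1.2] [cite: HatcherAT2002, §2.2 p. 140 (homology of ℂPⁿ)] -/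
theorem relEuler_complexProjectivePlane : relEuler ℤ ℤ ComplexProjectivePlane ∅ = 3 := by
  rw [relEuler_eq_two_add_finrank_singularHomology_two_of_simplyConnectedSpace
      (X := ComplexProjectivePlane),
    (ComplexProjectivePlane.singularHomologyTwoIso ℤ ℤ).toLinearEquiv.finrank_eq, Module.finrank_self]
  norm_num

/-- **`e(T⁴) = 0`, with finiteness, for every space homeomorphic to `(S¹ × S¹ × S¹) × S¹`**
(Mathlib's `Circle`; e.g. the recharted smooth `4`-torus of `FourTorusSignature.lean`):
`χ((ℝ/ℤ)² × (ℝ/ℤ)²) = 0` by the product formula `χ(K × T²) = 0` (the tree's PROVED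
`FinRelHomology.unitAddCircle_prod_unitAddCircle`, `FinRelHomology.prod_torus`; Hatcher Thm. 2.44),
transported along `X ≃ₜ (S¹)³ × S¹ ≃ₜ (ℝ/ℤ × ℝ/ℤ) × (ℝ/ℤ × ℝ/ℤ)` (`AddCircle.homeomorphCircle`).
[cite: HatcherAT2002, §2.2 Thm. 2.44] [cite: AkhmedovPark2010, §4 ("e(Z') = 1")] -/
theorem finRelHomology_and_relEuler_of_homeomorph_fourTorus {X : Type} [TopologicalSpace X]
    (e : X ≃ₜ (Circle × Circle × Circle) × Circle) :
    FinRelHomology ℤ ℤ X ∅ 5 ∧ relEuler ℤ ℤ X ∅ = 0 := by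
  obtain ⟨hT, -⟩ := FinRelHomology.unitAddCircle_prod_unitAddCircle ℤ ℤ
  obtain ⟨hT4, hT4e⟩ := FinRelHomology.prod_torus ℤ ℤ hT
  let c : Circle ≃ₜ AddCircle (1 : ℝ) := (AddCircle.homeomorphCircle one_ne_zero).symm
  let e' : X ≃ₜ (AddCircle (1 : ℝ) × AddCircle (1 : ℝ)) × (AddCircle (1 : ℝ) × AddCircle (1 : ℝ)) :=
    (e.trans ((c.prodCongr (c.prodCongr c)).prodCongr c)).trans
      ((Homeomorph.prodAssoc (AddCircle (1 : ℝ)) (AddCircle (1 : ℝ) × AddCircle (1 : ℝ))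
        (AddCircle (1 : ℝ))).trans
        (((Homeomorph.refl (AddCircle (1 : ℝ))).prodCongr
          (Homeomorph.prodAssoc (AddCircle (1 : ℝ)) (AddCircle (1 : ℝ)) (AddCircle (1 : ℝ)))).trans
          (Homeomorph.prodAssoc (AddCircle (1 : ℝ)) (AddCircle (1 : ℝ))
            (AddCircle (1 : ℝ) × AddCircle (1 : ℝ))).symm))
  refine ⟨hT4.of_homeomorph e'.symm (mapsTo_empty _ _) (mapsTo_empty _ _), ?_⟩
  rw [← hT4e]
  exact relEuler_eq_of_homeomorph (R := ℤ) (M := ℤ) (A := (∅ : Set X)) e'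
    (mapsTo_empty _ _) (mapsTo_empty _ _)

/-- **Akhmedov–Park 2010, §4: the oriented `T⁴ # ℂℙ²bar` has `(e, σ) = (1, -1)`** — both printed
invariants "`e(Z') = 1` and `σ(Z') = -1`" (before the torus surgeries producing `Z'`, `Z''`, which
preserve `e` and `σ` and are NOT formalised) on ONE model.  There are a closed connected smooth
`4`-manifold `X ≃ₜ (S¹ × S¹ × S¹) × S¹` (charted on `ℝ⁴`, `C^∞`) with a `ℤ`-orientation `μ` of
signature `0` and `e(X) = 0`, and a closed connected smooth `4`-manifold `P`, a connected sum of
`X` with `ℂℙ²` (`IsConnectedSum (𝓡 4) (𝓡 4) (𝓡 4) X ℂℙ² P`), carrying a `ℤ`-orientation of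
signature `-1`, with `b₂(P) = b₂(X) + 1` and **`e(P) = e(X) + e(ℂℙ²) - 2 = 0 + 3 - 2 = 1`**
(`exists_oriented_isConnectedSum_fourTorus_complexProjectivePlane` of `FourTorusSignature.lean`
with `IsConnectedSum.finRelHomology_and_relEuler_eq`, `relEuler_complexProjectivePlane`,
`finRelHomology_and_relEuler_of_homeomorph_fourTorus`).
[cite: AkhmedovPark2010, §4 ("e(Z') = e(Z''(1/q, m/r)) = 1 and σ(Z') = σ(Z''(1/q, m/r)) = −1")] [cite: GompfStipsicz1999, §1.2] -/
theorem exists_oriented_isConnectedSum_fourTorus_complexProjectivePlane_relEuler :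
    ∃ (X : Type) (_ : TopologicalSpace X) (_ : T2Space X) (_ : SecondCountableTopology X)
      (_ : ChartedSpace (EuclideanSpace ℝ (Fin 4)) X) (_ : IsManifold (𝓡 4) ∞ X)
      (_ : CompactSpace X) (_ : ConnectedSpace X),
      Nonempty (X ≃ₜ (Circle × Circle × Circle) × Circle) ∧ relEuler ℤ ℤ X ∅ = 0 ∧
        ∃ (μ : HomologicalOrientation ℤ X 4) (P : Type) (_ : TopologicalSpace P) (_ : T2Space P)
          (_ : SecondCountableTopology P) (_ : ChartedSpace (EuclideanSpace ℝ (Fin 4)) P)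
          (_ : IsManifold (𝓡 4) ∞ P) (_ : CompactSpace P) (_ : ConnectedSpace P)
          (μP : HomologicalOrientation ℤ P 4),
          μ.signature = 0 ∧ IsConnectedSum (𝓡 4) (𝓡 4) (𝓡 4) X ComplexProjectivePlane P ∧
            μP.signature = -1 ∧
              finrank ℤ (freeCohomology ℤ P 2) = finrank ℤ (freeCohomology ℤ X 2) + 1 ∧
                FinRelHomology ℤ ℤ P ∅ 6 ∧ relEuler ℤ ℤ P ∅ = 1 := by
  obtain ⟨X, _, _, _, _, _, _, _, ⟨eX⟩, μ, P, _, _, _, _, _, _, _, μP, hμ, hsum, hσ, hb⟩ :=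
    exists_oriented_isConnectedSum_fourTorus_complexProjectivePlane
  obtain ⟨-, hXe⟩ := finRelHomology_and_relEuler_of_homeomorph_fourTorus eX
  obtain ⟨hP, hPe⟩ := hsum.finRelHomology_and_relEuler_eq
  refine ⟨X, inferInstance, inferInstance, inferInstance, inferInstance, inferInstance,
    inferInstance, inferInstance, ⟨eX⟩, hXe, μ, P, inferInstance, inferInstance, inferInstance,
    inferInstance, inferInstance, inferInstance, inferInstance, μP, hμ, hsum, hσ, hb, hP, ?_⟩
  rw [hPe, hXe, relEuler_complexProjectivePlane]
  norm_num

end FourTorus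

end Literature.Topology.FourManifolds
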